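import Mathlib
import HarnessLib
import Summits.HubbardSuperconductivity.HubbardSuperconductivity.Theorems.KLProgrammeKLRegimeFrameOKDerivBounds
import Summits.HubbardSuperconductivity.HubbardSuperconductivity.Theorems.KLProgrammeKLRegimeEngineFrameLevelCount

/-!
# Route `KLProgramme` — engine support: the frame band in Pi coordinates, `e^Π_K := frameLevel μ K ∘ toLp : (Fin 2 → ℝ) → ℝ` — `C²`, its
# derivative through `toLp`, and the `√2`-transfer of the `FrameOK` bounds (`‖De^Π_K‖ ≤ 7√2`, `‖D²e^Π_K‖ ≤ 14`)

Cell `gate-hubbard-kl`, seat hubbard-kl-k3c2-p3; gen-4 ENGINE child stmt-HubbardSuperconductivity-19855 (`stub_engine_step_norms`, also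
`stub_engine_scale0`: k3c2-p1 g2's 01:05:58Z (D1)(a) ask).  The p4 lineage's sampled-symbol layer (`…SymbolProductSampled`,
`…SymbolCellGeometry`) is written for a band `e : (Fin 2 → ℝ) → ℝ` on the SUP-normed Pi type with `‖iteratedFDeriv ℝ 2 e‖ ≤ K₂`; the engine's
frames are `frameLevel μ K` on `EuclideanSpace ℝ (Fin 2)` with `FrameOK` (i) = `GeomConstants … 7 …`.  This file is the transfer:

* `norm_toLp_le` — `‖toLp 2 w‖ ≤ √2·‖w‖` (ℓ² vs sup on `Fin 2`), `opNorm_toLpCLM_le`;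
* `contDiff_frameLevelPi`, **`fderiv_frameLevelPi_apply`** (`D(e_K ∘ toLp)(p)·w = De_K(toLp p)·(toLp w)`);
* **`norm_iteratedFDeriv_two_frameLevelPi_le`** (`≤ 2K₂` from `‖D²e_K‖ ≤ K₂`), `norm_fderiv_frameLevelPi_le` (`≤ √2·K₁`);
* the `FrameOK` instances **`norm_iteratedFDeriv_two_frameLevelPi_le_of_frameOK`** (`≤ 14`), `norm_fderiv_frameLevelPi_le_of_frameOK` (`≤ 7√2`),
  `abs_frameLevelPi_le_of_frameOK` (`≤ 7`).

Everything is proved; no definitions (the Pi band is written out as `fun p => frameLevel μ K (WithLp.toLp 2 p)`), no named facts. [folklore]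
-/

noncomputable section

namespace Summit.HubbardSuperconductivity.HubbardSuperconductivity.Theorems.TorusFourierL2

set_option linter.dupNamespace false -- summit = problem name (single-conjunct summit), D-0017

open Literature.MathematicalPhysics.QuantumLattice Literature.Probability.LatticeModels
open Summit.HubbardSuperconductivity.HubbardSuperconductivity.Theorems.DispersionFlow
open Summit.HubbardSuperconductivity.HubbardSuperconductivity.Theorems.KLRegimeSplit

/-! ### §1 `toLp` on `Fin 2`: norms -/

/-- `‖toLp 2 w‖ ≤ √2·‖w‖` for `w : Fin 2 → ℝ` (Euclidean vs sup norm). [folklore] -/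
theorem norm_toLp_le (w : Fin 2 → ℝ) : ‖(WithLp.toLp 2 w : EuclideanSpace ℝ (Fin 2))‖ ≤ Real.sqrt 2 * ‖w‖ := by
  rw [EuclideanSpace.norm_eq, Fin.sum_univ_two]
  have h0 : ‖w 0‖ ≤ ‖w‖ := norm_le_pi_norm w 0
  have h1 : ‖w 1‖ ≤ ‖w‖ := norm_le_pi_norm w 1
  have hw : 0 ≤ ‖w‖ := norm_nonneg _
  calc Real.sqrt (‖(WithLp.toLp 2 w : EuclideanSpace ℝ (Fin 2)) 0‖ ^ 2 + ‖(WithLp.toLp 2 w : EuclideanSpace ℝ (Fin 2)) 1‖ ^ 2)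
      = Real.sqrt (‖w 0‖ ^ 2 + ‖w 1‖ ^ 2) := by rfl
    _ ≤ Real.sqrt (2 * ‖w‖ ^ 2) := by
        apply Real.sqrt_le_sqrt
        nlinarith [norm_nonneg (w 0), norm_nonneg (w 1)]
    _ = Real.sqrt 2 * ‖w‖ := by rw [Real.sqrt_mul (by norm_num), Real.sqrt_sq hw]

/-- The operator norm of `toLp 2 : (Fin 2 → ℝ) →L EuclideanSpace ℝ (Fin 2)` is `≤ √2`. [folklore] -/
theorem opNorm_toLpCLM_le :
    ‖((EuclideanSpace.equiv (Fin 2) ℝ).symm.toContinuousLinearMap)‖ ≤ Real.sqrt 2 := by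
  refine ContinuousLinearMap.opNorm_le_bound _ (Real.sqrt_nonneg _) fun w => ?_
  exact norm_toLp_le w

/-! ### §2 The Pi band: smoothness, derivative, second-derivative transfer -/

section Band

variable (μ : ℝ) (K : TrigPolyC4v)

/-- The Pi band is the Euclidean band composed with the continuous linear equivalence `toLp`. [folklore] -/
theorem frameLevelPi_eq_comp :
    (fun p : Fin 2 → ℝ => frameLevel μ K (WithLp.toLp 2 p)) =
      frameLevel μ K ∘ ((EuclideanSpace.equiv (Fin 2) ℝ).symm.toContinuousLinearMap) := by
  funext p; rfl

/-- **The Pi band is `C²`.** [folklore] -/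
theorem contDiff_frameLevelPi : ContDiff ℝ 2 fun p : Fin 2 → ℝ => frameLevel μ K (WithLp.toLp 2 p) := by
  rw [frameLevelPi_eq_comp]
  exact (EngineV8.contDiff_frameLevel μ K).comp (ContinuousLinearMap.contDiff _)

/-- **The derivative of the Pi band through `toLp`**: `D(e_K ∘ toLp)(p)·w = De_K(toLp p)·(toLp w)`. [folklore] -/
theorem fderiv_frameLevelPi_apply (p w : Fin 2 → ℝ) :
    fderiv ℝ (fun p : Fin 2 → ℝ => frameLevel μ K (WithLp.toLp 2 p)) p w =
      fderiv ℝ (frameLevel μ K) (WithLp.toLp 2 p) (WithLp.toLp 2 w) := by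
  have h : (fun p : Fin 2 → ℝ => frameLevel μ K (WithLp.toLp 2 p)) = frameLevel μ K ∘ ⇑((EuclideanSpace.equiv (Fin 2) ℝ).symm) := rfl
  rw [h, ContinuousLinearEquiv.comp_right_fderiv]
  rfl

variable {μ K}

/-- **Second-derivative transfer**: `‖D²(e_K ∘ toLp)(p)‖ ≤ 2K₂` from `‖D²e_K‖ ≤ K₂` (`‖toLp‖ ≤ √2`, twice). [folklore] -/
theorem norm_iteratedFDeriv_two_frameLevelPi_le {K₂ : ℝ} (hK₂ : ∀ x, ‖iteratedFDeriv ℝ 2 (frameLevel μ K) x‖ ≤ K₂) (p : Fin 2 → ℝ) :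
    ‖iteratedFDeriv ℝ 2 (fun p : Fin 2 → ℝ => frameLevel μ K (WithLp.toLp 2 p)) p‖ ≤ 2 * K₂ := by
  set A : (Fin 2 → ℝ) →L[ℝ] EuclideanSpace ℝ (Fin 2) := (EuclideanSpace.equiv (Fin 2) ℝ).symm.toContinuousLinearMap with hA
  have hK0 : 0 ≤ K₂ := le_trans (norm_nonneg _) (hK₂ 0)
  rw [frameLevelPi_eq_comp, ← hA, A.iteratedFDeriv_comp_right (EngineV8.contDiff_frameLevel μ K) p le_rfl]
  refine (ContinuousMultilinearMap.norm_compContinuousLinearMap_le _ _).trans ?_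
  rw [Fin.prod_univ_two]
  have hAn : ‖A‖ ≤ Real.sqrt 2 := opNorm_toLpCLM_le
  have hA0 : 0 ≤ ‖A‖ := norm_nonneg _
  have h2 : ‖A‖ * ‖A‖ ≤ 2 := by
    have := mul_le_mul hAn hAn hA0 (Real.sqrt_nonneg 2)
    rwa [Real.mul_self_sqrt (by norm_num : (0:ℝ) ≤ 2)] at this
  calc ‖iteratedFDeriv ℝ 2 (frameLevel μ K) (A p)‖ * (‖A‖ * ‖A‖) ≤ K₂ * 2 :=
        mul_le_mul (hK₂ _) h2 (mul_nonneg hA0 hA0) hK0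
    _ = 2 * K₂ := by ring

/-- **First-derivative transfer**: `‖D(e_K ∘ toLp)(p)‖ ≤ √2·K₁` from `‖De_K‖ ≤ K₁`. [folklore] -/
theorem norm_fderiv_frameLevelPi_le {K₁ : ℝ} (hK₁ : ∀ x, ‖fderiv ℝ (frameLevel μ K) x‖ ≤ K₁) (p : Fin 2 → ℝ) :
    ‖fderiv ℝ (fun p : Fin 2 → ℝ => frameLevel μ K (WithLp.toLp 2 p)) p‖ ≤ Real.sqrt 2 * K₁ := by
  have hK0 : 0 ≤ K₁ := le_trans (norm_nonneg _) (hK₁ 0)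
  refine ContinuousLinearMap.opNorm_le_bound _ (by positivity) fun w => ?_
  rw [fderiv_frameLevelPi_apply]
  calc ‖fderiv ℝ (frameLevel μ K) (WithLp.toLp 2 p) (WithLp.toLp 2 w)‖
      ≤ ‖fderiv ℝ (frameLevel μ K) (WithLp.toLp 2 p)‖ * ‖(WithLp.toLp 2 w : EuclideanSpace ℝ (Fin 2))‖ :=
        ContinuousLinearMap.le_opNorm _ _
    _ ≤ K₁ * (Real.sqrt 2 * ‖w‖) := mul_le_mul (hK₁ _) (norm_toLp_le w) (norm_nonneg _) hK0
    _ = Real.sqrt 2 * K₁ * ‖w‖ := by ring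

/-- `|D(e_K ∘ toLp)(p)·w| ≤ K₁·‖toLp w‖` — the directional form keeping the Euclidean length of the step. [folklore] -/
theorem abs_fderiv_frameLevelPi_apply_le {K₁ : ℝ} (hK₁ : ∀ x, ‖fderiv ℝ (frameLevel μ K) x‖ ≤ K₁) (p w : Fin 2 → ℝ) :
    |fderiv ℝ (fun p : Fin 2 → ℝ => frameLevel μ K (WithLp.toLp 2 p)) p w| ≤
      K₁ * ‖(WithLp.toLp 2 w : EuclideanSpace ℝ (Fin 2))‖ := by
  rw [fderiv_frameLevelPi_apply, ← Real.norm_eq_abs]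
  exact (ContinuousLinearMap.le_opNorm _ _).trans (mul_le_mul_of_nonneg_right (hK₁ _) (norm_nonneg _))

/-! ### §3 The `FrameOK` instances -/

/-- **`‖D²(e_K ∘ toLp)‖ ≤ 14`** for an admissible frame. [folklore] -/
theorem norm_iteratedFDeriv_two_frameLevelPi_le_of_frameOK {R : RenConsts} {U : ℝ} {N : ℕ} (hK : FrameOK R U N μ K)
    (p : Fin 2 → ℝ) : ‖iteratedFDeriv ℝ 2 (fun p : Fin 2 → ℝ => frameLevel μ K (WithLp.toLp 2 p)) p‖ ≤ 14 := by
  have h := norm_iteratedFDeriv_two_frameLevelPi_le (norm_iteratedFDeriv_two_frameLevel_le_of_frameOK hK) p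
  linarith

/-- **`‖D(e_K ∘ toLp)‖ ≤ 7√2`** for an admissible frame. [folklore] -/
theorem norm_fderiv_frameLevelPi_le_of_frameOK {R : RenConsts} {U : ℝ} {N : ℕ} (hK : FrameOK R U N μ K) (p : Fin 2 → ℝ) :
    ‖fderiv ℝ (fun p : Fin 2 → ℝ => frameLevel μ K (WithLp.toLp 2 p)) p‖ ≤ Real.sqrt 2 * 7 :=
  norm_fderiv_frameLevelPi_le (norm_fderiv_frameLevel_le_of_frameOK hK) p

/-- `|D(e_K ∘ toLp)(p)·w| ≤ 7·‖toLp w‖` for an admissible frame. [folklore] -/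
theorem abs_fderiv_frameLevelPi_apply_le_of_frameOK {R : RenConsts} {U : ℝ} {N : ℕ} (hK : FrameOK R U N μ K)
    (p w : Fin 2 → ℝ) :
    |fderiv ℝ (fun p : Fin 2 → ℝ => frameLevel μ K (WithLp.toLp 2 p)) p w| ≤ 7 * ‖(WithLp.toLp 2 w : EuclideanSpace ℝ (Fin 2))‖ :=
  abs_fderiv_frameLevelPi_apply_le (norm_fderiv_frameLevel_le_of_frameOK hK) p w

/-- `|e_K(toLp p)| ≤ 7` for an admissible frame (restated in Pi form for the sampled-symbol layer). [folklore] -/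
theorem abs_frameLevelPi_le_of_frameOK {R : RenConsts} {U : ℝ} {N : ℕ} (hK : FrameOK R U N μ K) (p : Fin 2 → ℝ) :
    |frameLevel μ K (WithLp.toLp 2 p)| ≤ 7 :=
  abs_frameLevel_le_of_frameOK hK _

end Band

end Summit.HubbardSuperconductivity.HubbardSuperconductivity.Theorems.TorusFourierL2

end
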